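import Mathlib
import Literature.MathematicalPhysics.QuantumLattice.FermiRG.Salmhofer1998DotCovKernelCalculus
import Literature.MathematicalPhysics.QuantumLattice.FermiRG.Salmhofer1998TorusIBP
import Literature.MathematicalPhysics.QuantumLattice.FermiRG.Salmhofer1998SublevelVolume
import Literature.MathematicalPhysics.QuantumLattice.FermiRG.Salmhofer1998MatsubaraSums
import HarnessLib

/-!
# Salmhofer 1998, Lemma 5 — the decay estimate (5.24) for `Ḋ_t(x₀,𝐱)`

M. Salmhofer, *Continuous renormalization for fermions and Fermi liquid theory*, Commun. Math. Phys.
**194** (1998) 249–295 = arXiv:cond-mat/9706188 [Salmhofer1998], §5.5, proof of Lemma 5 (render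
`paper:arxiv-cond-mat_9706188` p.20 L66–104; locators `p.N Ln` = chunk `pNNNN.txt` line `n`).

Theorem-only companion of the FROZEN statement file `Salmhofer1998Sec5.lean` (licence F-086
`DotCovarianceL1Bound`; no definition, no named fact, net debt `0`).  For the position-space kernel
`Ḋ_t(x₀,𝐱)` of (5.23) (`dotCovPos`) this file proves the analogue of the printed **claim (5.24)**,
`|Ḋ_t(x₀,𝐱)| ≤ N ε_t (1+ε_t|𝐱|)^{-k₀} (1+ε_t min{|x₀|, β/2-|x₀|})^{-2}`, in the form
`‖Ḋ_t(x₀, ε𝐧)‖ ≤ N ε_t / (max{1,(ε_t|x₀|)²} · max{1,(ε_t ‖ε𝐧‖_∞)^{k₀}})` for `|x₀| ≤ β/2`, `𝐧 ∈ ℤ^d`,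
with `N` depending on the model and the cutoff only (`exists_dotCovPos_decay`).  Steps, following
p.20 L84–104: (5.23) is a finite Matsubara sum (`dotCovPos_eq_sum`, via (5.14)); summation by parts
twice in `k₀` (`sq_mul_dotCovPos_eq_sum`, (5.25′)); `k₀` integrations by parts in one lattice
coordinate (toolkit II); the derivative bounds `|∂_j^m Δ^q 𝒞̇_t| ≤ N₁ a^q ε_t^{-1-m-q} 1(|E| ≤ ε_t)`
((5.25), toolkits I–II) and the shell volume `≤ C_E ε_t` (toolkit III, replacing `2J₁ε_t`); the
Matsubara count `≤ 2βε_t/π`; and `|1 - e^{2πix₀/β}| ≥ 4|x₀|/β` (toolkit IV; the print's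
`min{|x₀|, β/2-|x₀|}` is `|x₀|` on `|x₀| ≤ β/2` up to the stronger side).

No `instance`, no `notation`, no sorry/axiom; nothing about the Hubbard model is asserted or denied.
-/

noncomputable section

open Filter Function MeasureTheory Set
open scoped Topology ContDiff

namespace Literature.MathematicalPhysics.QuantumLattice.FermiRG

namespace Salmhofer1998

variable {d : ℕ}

/-! ### Integrability on the Brillouin-zone box -/

/-- The box `bzBox` is measurable. [cite: Salmhofer1998, §2.3 (p.6 L142–144)] -/
theorem measurableSet_bzBox (d : ℕ) (latt : ℝ) : MeasurableSet (bzBox d latt) :=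
  MeasurableSet.univ_pi fun _ => measurableSet_Ico

/-- A continuous function is integrable on the (bounded) box `bzBox`. [cite: Salmhofer1998, §2.3 (p.6 L142–144)] -/
theorem integrableOn_bzBox_of_continuous {h : (Fin d → ℝ) → ℂ} (hh : Continuous h) (latt : ℝ) :
    IntegrableOn h (bzBox d latt) := by
  have hK : IsCompact (Set.pi Set.univ fun _ : Fin d =>
      Set.Icc (-(Real.pi / latt)) (Real.pi / latt)) := isCompact_univ_pi fun _ => isCompact_Icc
  exact (hh.continuousOn.integrableOn_compact hK).mono_set (bzBox_subset_pi_Icc d latt)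

/-- `‖∫_box e^{i𝐤·𝐱} h‖ ≤ ∫_box ‖h‖`. [cite: Salmhofer1998, Lemma 5 proof (p.20 L84–90)] -/
theorem norm_setIntegral_phase_mul_le (x : Fin d → ℝ) (h : (Fin d → ℝ) → ℂ) (s : Set (Fin d → ℝ)) :
    ‖∫ k in s, Complex.exp (Complex.I * ((∑ i, k i * x i : ℝ) : ℂ)) * h k‖ ≤ ∫ k in s, ‖h k‖ := by
  refine (norm_integral_le_integral_norm _).trans (le_of_eq ?_)
  congr 1
  funext k
  rw [norm_mul, mul_comm Complex.I, Complex.norm_exp_ofReal_mul_I, one_mul]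

/-- The phase is continuous. [cite: Salmhofer1998, Lemma 5 proof (p.20 L70–75)] -/
theorem continuous_phase (x : Fin d → ℝ) :
    Continuous fun k : Fin d → ℝ => Complex.exp (Complex.I * ((∑ i, k i * x i : ℝ) : ℂ)) := by
  have h1 : Continuous fun k : Fin d → ℝ => (∑ i, k i * x i : ℝ) :=
    continuous_finsetSum _ fun i _ => (continuous_apply i).mul continuous_const
  exact Complex.continuous_exp.comp (continuous_const.mul (Complex.continuous_ofReal.comp h1))

/-- **The shell engine**: if `‖h‖ ≤ B` everywhere and `h = 0` off the shell `{|E| ≤ ε}`, then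
`∫_box ‖h‖ ≤ B · vol(box ∩ shell) ≤ B C_V ε`. [cite: Salmhofer1998, Lemma 5 proof (5.25)–(5.26) (p.20 L99–108)] -/
theorem setIntegral_norm_le_of_shell {M : ModelData d} {h : (Fin d → ℝ) → ℂ} {B ε V : ℝ}
    (hB0 : 0 ≤ B) (hB : ∀ k, ‖h k‖ ≤ B) (hz : ∀ k, ε < |M.E k| → h k = 0) (hV : 0 ≤ V)
    (hvol : volume (bzBox d M.latt ∩ {p | |M.E p| ≤ ε}) ≤ ENNReal.ofReal V) :
    ∫ k in bzBox d M.latt, ‖h k‖ ≤ B * V := by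
  have hsub : bzBox d M.latt ∩ {p | |M.E p| ≤ ε} ⊆ bzBox d M.latt := Set.inter_subset_left
  rw [setIntegral_eq_of_subset_of_forall_sdiff_eq_zero (measurableSet_bzBox d M.latt) hsub ?_]
  · have hfin : volume (bzBox d M.latt ∩ {p | |M.E p| ≤ ε}) < ⊤ :=
      lt_of_le_of_lt hvol ENNReal.ofReal_lt_top
    have h1 := norm_setIntegral_le_of_norm_le_const hfin
      (f := fun k => (‖h k‖ : ℝ)) (C := B) (fun k _ => by simpa using hB k)
    calc ∫ k in bzBox d M.latt ∩ {p | |M.E p| ≤ ε}, ‖h k‖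
        ≤ ‖∫ k in bzBox d M.latt ∩ {p | |M.E p| ≤ ε}, ‖h k‖‖ := Real.le_norm_self _
      _ ≤ B * (volume (bzBox d M.latt ∩ {p | |M.E p| ≤ ε})).toReal := h1
      _ ≤ B * V := by gcongr; exact ENNReal.toReal_le_of_le_ofReal hV hvol
  · intro k hk
    rw [Set.mem_sdiff] at hk
    have : ¬ |M.E k| ≤ ε := fun hle => hk.2 ⟨hk.1, hle⟩
    rw [hz k (lt_of_not_ge this), norm_zero]

/-! ### (5.23) as a finite Matsubara sum; summation by parts -/

section Sum

variable {M : ModelData d} {χ₁ : ℝ → ℝ}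

/-- `𝒞̇_t(ω_n, y) = 0` for every `y` once `|ω_n| > ε_t`. [cite: Salmhofer1998, Lemma 4 proof (p.20 L2–3)] -/
theorem covCDot_eq_zero_of_lt (hχ : IsCutoff χ₁) (h0 : 0 < M.eps0) {t x : ℝ}
    (hx : epsT M.eps0 t < |x|) (y : ℝ) : covCDot χ₁ M.eps0 t x y = 0 := by
  rw [covCDot_eq_scaledSlice hχ h0]
  exact scaledSlice_eq_zero_of_lt_abs' (kerProfile_eq_zero hχ) (epsT_pos h0 t) hx y

/-- `𝒞̇_t(x, y) = 0` once `|y| > ε_t`. [cite: Salmhofer1998, Lemma 4 (5.18) second line (p.19 L142–145)] -/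
theorem covCDot_eq_zero_of_lt' (hχ : IsCutoff χ₁) (h0 : 0 < M.eps0) {t y : ℝ} (x : ℝ)
    (hy : epsT M.eps0 t < |y|) : covCDot χ₁ M.eps0 t x y = 0 := by
  rw [covCDot_eq_scaledSlice hχ h0]
  exact scaledSlice_eq_zero_of_lt_abs (kerProfile_eq_zero hχ) (epsT_pos h0 t) x hy

/-- `𝐤 ↦ 𝒞̇_t(x, E(𝐤))` is `C^{k₀}`. [cite: Salmhofer1998, Lemma 5 proof (p.20 L99–101)] -/
theorem contDiff_covCDot_comp (hM : M.Hyp) (hχ : IsCutoff χ₁) (t x : ℝ) :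
    ContDiff ℝ M.k0 fun k : Fin d → ℝ => covCDot χ₁ M.eps0 t x (M.E k) :=
  ((contDiff_covCDot hχ hM.eps0_pos t x).of_le (mod_cast le_top)).comp hM.contDiff_E

/-- `𝐤 ↦ 𝒞̇_t(x, E(𝐤))` is continuous. [cite: Salmhofer1998, Lemma 5 proof (p.20 L99–101)] -/
theorem continuous_covCDot_comp (hM : M.Hyp) (hχ : IsCutoff χ₁) (t x : ℝ) :
    Continuous fun k : Fin d → ℝ => covCDot χ₁ M.eps0 t x (M.E k) :=
  (contDiff_covCDot_comp hM hχ t x).continuous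

/-- Pulling the phase `e^{ix₀ω}` and the constants out of the `𝐤`-integral.
[cite: Salmhofer1998, Lemma 5 (5.23) (p.20 L70–75)] -/
theorem inner_integral_eq (M : ModelData d) (χ₁ : ℝ → ℝ) (t x₀ w : ℝ) (x : Fin d → ℝ) :
    (((2 * Real.pi)⁻¹ : ℝ) • ∫ k in bzBox d M.latt, (((2 * Real.pi) ^ d)⁻¹ : ℝ) •
      (Complex.exp (Complex.I * ((x₀ * w + ∑ i, k i * x i : ℝ) : ℂ)) *
        covCDot χ₁ M.eps0 t w (M.E k))) =
      (((2 * Real.pi)⁻¹ * ((2 * Real.pi) ^ d)⁻¹ : ℝ) : ℂ) *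
        (Complex.exp (Complex.I * ((x₀ * w : ℝ) : ℂ)) *
          ∫ k in bzBox d M.latt, Complex.exp (Complex.I * ((∑ i, k i * x i : ℝ) : ℂ)) *
            covCDot χ₁ M.eps0 t w (M.E k)) := by
  rw [integral_smul, Complex.real_smul, Complex.real_smul]
  have h1 : (∫ k in bzBox d M.latt, Complex.exp (Complex.I * ((x₀ * w + ∑ i, k i * x i : ℝ) : ℂ)) *
      covCDot χ₁ M.eps0 t w (M.E k)) =
      Complex.exp (Complex.I * ((x₀ * w : ℝ) : ℂ)) *
        ∫ k in bzBox d M.latt, Complex.exp (Complex.I * ((∑ i, k i * x i : ℝ) : ℂ)) *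
          covCDot χ₁ M.eps0 t w (M.E k) := by
    rw [← integral_const_mul]
    congr 1
    funext k
    push_cast
    rw [mul_add, Complex.exp_add]
    ring
  rw [h1]
  push_cast
  ring

/-- **(5.23) is a finite Matsubara sum**: with `S = {n : |ω_n| ≤ ε_t}`,
`Ḋ_t(x₀,𝐱) = β⁻¹(2π)^{-d} Σ_{n∈S} e^{ix₀ω_n} ∫_𝓑 e^{i𝐤·𝐱} 𝒞̇_t(ω_n, E(𝐤)) d𝐤` (by (5.14), the
integrand vanishing for `|ω_β(k₀)| > ε_t`). [cite: Salmhofer1998, Lemma 5 (5.23) (p.20 L70–75); (5.14) (p.19 L100–105)] -/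
theorem dotCovPos_eq_sum (hM : M.Hyp) (hχ : IsCutoff χ₁) {β : ℝ} (hβ : 0 < β) (t x₀ : ℝ)
    (x : Fin d → ℝ) {S : Finset ℤ} (hS : ∀ n : ℤ, n ∈ S ↔ |matsFreq β n| ≤ epsT M.eps0 t) :
    dotCovPos M χ₁ β t x₀ x =
      ((β⁻¹ * ((2 * Real.pi) ^ d)⁻¹ : ℝ) : ℂ) * ∑ n ∈ S,
        Complex.exp (Complex.I * ((x₀ * matsFreq β n : ℝ) : ℂ)) *
          ∫ k in bzBox d M.latt, Complex.exp (Complex.I * ((∑ i, k i * x i : ℝ) : ℂ)) *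
            covCDot χ₁ M.eps0 t (matsFreq β n) (M.E k) := by
  set f : ℝ → ℂ := fun w => ((2 * Real.pi)⁻¹ : ℝ) • ∫ k in bzBox d M.latt,
    (((2 * Real.pi) ^ d)⁻¹ : ℝ) • (Complex.exp (Complex.I * ((x₀ * w + ∑ i, k i * x i : ℝ) : ℂ)) *
      covCDot χ₁ M.eps0 t w (M.E k)) with hf
  have hLHS : dotCovPos M χ₁ β t x₀ x = ∫ k₀ : ℝ, f (omegaStep β k₀) := rfl
  have hf0 : ∀ n : ℤ, n ∉ S → f (matsFreq β n) = 0 := by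
    intro n hn
    have hlt : epsT M.eps0 t < |matsFreq β n| := lt_of_not_ge fun h => hn ((hS n).mpr h)
    simp only [hf]
    rw [setIntegral_eq_zero_of_forall_eq_zero, smul_zero]
    intro k _
    rw [covCDot_eq_zero_of_lt hχ hM.eps0_pos hlt, mul_zero, smul_zero]
  rw [hLHS, integral_comp_omegaStep_eq_sum hβ S hf0, Finset.mul_sum, Finset.mul_sum]
  refine Finset.sum_congr rfl fun n _ => ?_
  simp only [hf]
  rw [inner_integral_eq]
  have hπ : (2 * Real.pi : ℂ) ≠ 0 := by exact_mod_cast (by positivity : (2 * Real.pi : ℝ) ≠ 0)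
  have hβ' : (β : ℂ) ≠ 0 := by exact_mod_cast hβ.ne'
  push_cast
  field_simp

/-- Linearity of the `𝐤`-integral for the second difference in the frequency slot.
[cite: Salmhofer1998, Lemma 5 proof (5.25′) (p.20 L92–98)] -/
theorem integral_secondDiff_eq (hM : M.Hyp) (hχ : IsCutoff χ₁) (t x' a : ℝ) (x : Fin d → ℝ) :
    (∫ k in bzBox d M.latt, Complex.exp (Complex.I * ((∑ i, k i * x i : ℝ) : ℂ)) *
        covCDot χ₁ M.eps0 t x' (M.E k)) -
      2 * (∫ k in bzBox d M.latt, Complex.exp (Complex.I * ((∑ i, k i * x i : ℝ) : ℂ)) *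
        covCDot χ₁ M.eps0 t (x' - a) (M.E k)) +
      (∫ k in bzBox d M.latt, Complex.exp (Complex.I * ((∑ i, k i * x i : ℝ) : ℂ)) *
        covCDot χ₁ M.eps0 t (x' - 2 * a) (M.E k)) =
    ∫ k in bzBox d M.latt, Complex.exp (Complex.I * ((∑ i, k i * x i : ℝ) : ℂ)) *
      (covCDot χ₁ M.eps0 t x' (M.E k) - 2 * covCDot χ₁ M.eps0 t (x' - a) (M.E k) +
        covCDot χ₁ M.eps0 t (x' - 2 * a) (M.E k)) := by
  have hph := continuous_phase x
  have hi : ∀ z : ℝ, IntegrableOn (fun k : Fin d → ℝ =>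
      Complex.exp (Complex.I * ((∑ i, k i * x i : ℝ) : ℂ)) * covCDot χ₁ M.eps0 t z (M.E k))
      (bzBox d M.latt) := fun z =>
    integrableOn_bzBox_of_continuous (hph.mul (continuous_covCDot_comp hM hχ t z)) _
  have h2 : IntegrableOn (fun k : Fin d → ℝ =>
      2 * (Complex.exp (Complex.I * ((∑ i, k i * x i : ℝ) : ℂ)) * covCDot χ₁ M.eps0 t (x' - a) (M.E k)))
      (bzBox d M.latt) := (hi (x' - a)).const_mul 2
  have h12 : IntegrableOn (fun k : Fin d → ℝ =>
      Complex.exp (Complex.I * ((∑ i, k i * x i : ℝ) : ℂ)) * covCDot χ₁ M.eps0 t x' (M.E k) -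
        2 * (Complex.exp (Complex.I * ((∑ i, k i * x i : ℝ) : ℂ)) *
          covCDot χ₁ M.eps0 t (x' - a) (M.E k))) (bzBox d M.latt) := (hi x').sub h2
  have hsplit : (∫ k in bzBox d M.latt, Complex.exp (Complex.I * ((∑ i, k i * x i : ℝ) : ℂ)) *
      (covCDot χ₁ M.eps0 t x' (M.E k) - 2 * covCDot χ₁ M.eps0 t (x' - a) (M.E k) +
        covCDot χ₁ M.eps0 t (x' - 2 * a) (M.E k))) =
      ∫ k in bzBox d M.latt, ((Complex.exp (Complex.I * ((∑ i, k i * x i : ℝ) : ℂ)) *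
          covCDot χ₁ M.eps0 t x' (M.E k) -
        2 * (Complex.exp (Complex.I * ((∑ i, k i * x i : ℝ) : ℂ)) *
          covCDot χ₁ M.eps0 t (x' - a) (M.E k))) +
        Complex.exp (Complex.I * ((∑ i, k i * x i : ℝ) : ℂ)) *
          covCDot χ₁ M.eps0 t (x' - 2 * a) (M.E k)) := by
    refine setIntegral_congr_fun (measurableSet_bzBox d M.latt) fun k _ => ?_
    ring
  rw [hsplit, integral_add h12 (hi (x' - 2 * a)), integral_sub (hi x') h2, integral_const_mul]

/-- **Summation by parts twice ((5.25′), `q = 2`)**: with `a = 2π/β`, `S = {n : |ω_n| ≤ ε_t}` and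
`T = S ∪ (S+1) ∪ (S+2)`,
`(1 - e^{iax₀})² Ḋ_t(x₀,𝐱) = β⁻¹(2π)^{-d} Σ_{n∈T} e^{ix₀ω_n} ∫_𝓑 e^{i𝐤·𝐱} (Δ²_a 𝒞̇_t)(ω_n, E(𝐤)) d𝐤`,
`(Δ²_a g)(x) = g(x) - 2g(x-a) + g(x-2a)`. [cite: Salmhofer1998, Lemma 5 proof (5.25′) (p.20 L92–98)] -/
theorem sq_mul_dotCovPos_eq_sum (hM : M.Hyp) (hχ : IsCutoff χ₁) {β : ℝ} (hβ : 0 < β) (t x₀ : ℝ)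
    (x : Fin d → ℝ) {S : Finset ℤ} (hS : ∀ n : ℤ, n ∈ S ↔ |matsFreq β n| ≤ epsT M.eps0 t) :
    (1 - Complex.exp (Complex.I * ((x₀ * (2 * Real.pi / β) : ℝ) : ℂ))) ^ 2 * dotCovPos M χ₁ β t x₀ x =
      ((β⁻¹ * ((2 * Real.pi) ^ d)⁻¹ : ℝ) : ℂ) *
        ∑ n ∈ (S ∪ S.image (fun n => n + 1) ∪ S.image (fun n => n + 2)),
          Complex.exp (Complex.I * ((x₀ * matsFreq β n : ℝ) : ℂ)) *
            ∫ k in bzBox d M.latt, Complex.exp (Complex.I * ((∑ i, k i * x i : ℝ) : ℂ)) *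
              (covCDot χ₁ M.eps0 t (matsFreq β n) (M.E k) -
                2 * covCDot χ₁ M.eps0 t (matsFreq β n - 2 * Real.pi / β) (M.E k) +
                covCDot χ₁ M.eps0 t (matsFreq β n - 2 * (2 * Real.pi / β)) (M.E k)) := by
  rw [dotCovPos_eq_sum hM hχ hβ t x₀ x hS]
  set c : ℤ → ℂ := fun n => ∫ k in bzBox d M.latt,
    Complex.exp (Complex.I * ((∑ i, k i * x i : ℝ) : ℂ)) * covCDot χ₁ M.eps0 t (matsFreq β n) (M.E k)
    with hc
  set e : ℤ → ℂ := fun n => Complex.exp (Complex.I * ((x₀ * matsFreq β n : ℝ) : ℂ)) with he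
  have hshift : ∀ n : ℤ, Complex.exp (Complex.I * ((x₀ * (2 * Real.pi / β) : ℝ) : ℂ)) * e n =
      e (n + 1) := fun n => exp_shift_mul_exp_matsFreq β x₀ n
  have hc0 : ∀ n, n ∉ S → c n = 0 := by
    intro n hn
    have hlt : epsT M.eps0 t < |matsFreq β n| := lt_of_not_ge fun h => hn ((hS n).mpr h)
    simp only [hc]
    apply setIntegral_eq_zero_of_forall_eq_zero
    intro k _
    rw [covCDot_eq_zero_of_lt hχ hM.eps0_pos hlt, mul_zero]
  have key := sq_one_sub_mul_sum_eq hshift hc0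
  rw [mul_left_comm, key]
  congr 1
  refine Finset.sum_congr rfl fun n _ => ?_
  simp only [hc, he]
  congr 1
  have h1 : matsFreq β (n - 1) = matsFreq β n - 2 * Real.pi / β := by
    have := matsFreq_sub_int β n 1; push_cast at this; linarith
  have h2 : matsFreq β (n - 2) = matsFreq β n - 2 * (2 * Real.pi / β) := by
    have := matsFreq_sub_int β n 2; push_cast at this; linarith
  rw [h1, h2]
  exact integral_secondDiff_eq hM hχ t _ _ x

end Sum

/-! ### The four bounds on the `𝐤`-integrals -/

section Bounds

variable {M : ModelData d} {χ₁ : ℝ → ℝ}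

/-- `ε_t ≤ 1` for `t ≥ 0` (`ε_t ≤ ε₀ ≤ 1`). [cite: Salmhofer1998, §5.4 (p.20 L26)] -/
theorem epsT_le_one (hM : M.Hyp) {t : ℝ} (ht : 0 ≤ t) : epsT M.eps0 t ≤ 1 :=
  (epsT_le hM.eps0_pos.le ht).trans hM.eps0_le_one

/-- `y ↦ 𝒞̇_t(x, y)` is the scaled slice of the profile. [cite: Salmhofer1998, Lemma 5 proof (p.20 L80–82)] -/
theorem covCDot_fun_eq_scaledSlice (hχ : IsCutoff χ₁) (h0 : 0 < M.eps0) (t x : ℝ) :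
    (fun y : ℝ => covCDot χ₁ M.eps0 t x y) = scaledSlice (kerProfile χ₁) (epsT M.eps0 t) x := by
  funext y; exact covCDot_eq_scaledSlice hχ h0 t x y

/-- **Bound `q = 0`, `m = 0`**: `∫_𝓑 |𝒞̇_t(x', E(𝐤))| d𝐤 ≤ C_A ε_t⁻¹ · C_E ε_t` (pointwise `|𝒞̇_t| ≤ C_Aε_t⁻¹`
on the shell `|E| ≤ ε_t`, zero outside). [cite: Salmhofer1998, Lemma 5 proof (5.25)–(5.26) (p.20 L99–108)] -/
theorem integral_norm_kernel_le (hM : M.Hyp) (hχ : IsCutoff χ₁) {CA CV : ℝ} (hCA : 0 ≤ CA)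
    (hA : ∀ ε : ℝ, 0 < ε → ∀ (x : ℝ) (n : ℕ), n ≤ M.k0 → ∀ y : ℝ,
      ‖iteratedDeriv n (scaledSlice (kerProfile χ₁) ε x) y‖ ≤ CA * (ε⁻¹) ^ (n + 1))
    (hV : ∀ ε : ℝ, 0 < ε → ε ≤ 1 →
      volume (bzBox d M.latt ∩ {p | |M.E p| ≤ ε}) ≤ ENNReal.ofReal (CV * ε)) (hCV : 0 ≤ CV)
    {t : ℝ} (ht : 0 ≤ t) (x' : ℝ) :
    ∫ k in bzBox d M.latt, ‖covCDot χ₁ M.eps0 t x' (M.E k)‖ ≤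
      CA * (epsT M.eps0 t)⁻¹ * (CV * epsT M.eps0 t) := by
  have hε := epsT_pos hM.eps0_pos t
  refine setIntegral_norm_le_of_shell (by positivity) ?_ ?_ (by positivity) (hV _ hε (epsT_le_one hM ht))
  · intro k
    have := hA _ hε x' 0 (Nat.zero_le _) (M.E k)
    rw [iteratedDeriv_zero, ← covCDot_fun_eq_scaledSlice hχ hM.eps0_pos, zero_add, pow_one] at this
    exact this
  · intro k hk
    exact covCDot_eq_zero_of_lt' hχ hM.eps0_pos x' hk

/-- **Bound `q = 2`, `m = 0`**: `∫_𝓑 |(Δ²_a 𝒞̇_t)(x', E(𝐤))| d𝐤 ≤ C_B a² ε_t⁻³ · C_E ε_t`.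
[cite: Salmhofer1998, Lemma 5 proof (5.25)–(5.26) (p.20 L99–108)] -/
theorem integral_norm_kernel_diff_le (hM : M.Hyp) (hχ : IsCutoff χ₁) {CB CV : ℝ} (hCB : 0 ≤ CB)
    (hB : ∀ ε : ℝ, 0 < ε → ∀ (x a : ℝ) (n : ℕ), n ≤ M.k0 → ∀ y : ℝ,
      ‖iteratedDeriv n (scaledSlice (kerProfile χ₁) ε x) y -
          2 * iteratedDeriv n (scaledSlice (kerProfile χ₁) ε (x - a)) y +
          iteratedDeriv n (scaledSlice (kerProfile χ₁) ε (x - 2 * a)) y‖ ≤ CB * a ^ 2 * (ε⁻¹) ^ (n + 3))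
    (hV : ∀ ε : ℝ, 0 < ε → ε ≤ 1 →
      volume (bzBox d M.latt ∩ {p | |M.E p| ≤ ε}) ≤ ENNReal.ofReal (CV * ε)) (hCV : 0 ≤ CV)
    {t : ℝ} (ht : 0 ≤ t) (x' a : ℝ) :
    ∫ k in bzBox d M.latt, ‖covCDot χ₁ M.eps0 t x' (M.E k) - 2 * covCDot χ₁ M.eps0 t (x' - a) (M.E k) +
        covCDot χ₁ M.eps0 t (x' - 2 * a) (M.E k)‖ ≤
      CB * a ^ 2 * ((epsT M.eps0 t)⁻¹) ^ 3 * (CV * epsT M.eps0 t) := by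
  have hε := epsT_pos hM.eps0_pos t
  refine setIntegral_norm_le_of_shell (by positivity) ?_ ?_ (by positivity)
    (hV _ hε (epsT_le_one hM ht))
  · intro k
    have := hB _ hε x' a 0 (Nat.zero_le _) (M.E k)
    simp only [iteratedDeriv_zero, zero_add] at this
    rw [← covCDot_fun_eq_scaledSlice hχ hM.eps0_pos, ← covCDot_fun_eq_scaledSlice hχ hM.eps0_pos,
      ← covCDot_fun_eq_scaledSlice hχ hM.eps0_pos] at this
    exact this
  · intro k hk
    rw [covCDot_eq_zero_of_lt' hχ hM.eps0_pos x' hk, covCDot_eq_zero_of_lt' hχ hM.eps0_pos _ hk,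
      covCDot_eq_zero_of_lt' hχ hM.eps0_pos _ hk]
    ring

/-- The lattice vector `(2π/ε) e_j` is `2b·e_j` with `b = π/ε`. [cite: Salmhofer1998, §2.3 (p.6 L142–144)] -/
theorem recipVec_single {n : ℕ} (latt : ℝ) (j : Fin (n + 1)) :
    recipVec latt (Pi.single j (1 : ℤ)) =
      (2 * (Real.pi / latt)) • (Pi.single j (1 : ℝ) : Fin (n + 1) → ℝ) := by
  ext i
  simp only [recipVec, Pi.smul_apply, smul_eq_mul, Pi.single_apply]
  split_ifs with h
  · push_cast; ring
  · push_cast; ring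

/-- Periodicity of `𝐤 ↦ g(E(𝐤))` in a lattice coordinate. [cite: Salmhofer1998, §2.3 (p.6 L144–148)] -/
theorem comp_E_periodic {n : ℕ} {M : ModelData (n + 1)} (hM : M.Hyp) (g : ℝ → ℂ) (j : Fin (n + 1))
    (k : Fin (n + 1) → ℝ) :
    g (M.E (k + (2 * (Real.pi / M.latt)) • (Pi.single j (1 : ℝ) : Fin (n + 1) → ℝ))) = g (M.E k) := by
  rw [← recipVec_single, hM.periodic_E]

/-- For `𝐱 ∈ εℤ^d`, `e^{2ib x_j} = 1` (`b = π/ε`). [cite: Salmhofer1998, Lemma 5 proof (p.20 L66–68)] -/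
theorem exp_two_b_mul_lattice {n : ℕ} {latt : ℝ} (hl : latt ≠ 0) (j : Fin (n + 1))
    (nv : Fin (n + 1) → ℤ) :
    Complex.exp (Complex.I * ((2 * (Real.pi / latt) * (latt * (nv j : ℝ)) : ℝ) : ℂ)) = 1 := by
  have : (2 * (Real.pi / latt) * (latt * (nv j : ℝ)) : ℝ) = (nv j : ℝ) * (2 * Real.pi) := by
    field_simp
  rw [this]
  have h := Complex.exp_int_mul_two_pi_mul_I (nv j)
  rw [← h]
  congr 1
  push_cast
  ring

/-- **Bound `m = k₀` (both `q`)**, the integration-by-parts estimate: for `G ∈ C^{k₀}` of the form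
`𝐤 ↦ g(E(𝐤))` with `‖g^{(i)}‖ ≤ C` (`i ≤ k₀`) and `g = 0` off `[-ε_t, ε_t]`, and `𝐱 ∈ εℤ^{n+1}`:
`|x_j|^{k₀} ‖∫_𝓑 e^{i𝐤·𝐱} g(E(𝐤)) d𝐤‖ ≤ k₀! C D^{k₀} · C_E ε_t`.
[cite: Salmhofer1998, Lemma 5 proof (5.24)–(5.26) (p.20 L84–108)] -/
theorem pow_mul_norm_integral_le {n : ℕ} {M : ModelData (n + 1)} (hM : M.Hyp) {g : ℝ → ℂ}
    (hg : ContDiff ℝ M.k0 g) {C D CV ε : ℝ} (hC0 : 0 ≤ C) (hD1 : 1 ≤ D)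
    (hC : ∀ i, i ≤ M.k0 → ∀ y : ℝ, ‖iteratedDeriv i g y‖ ≤ C)
    (hgz : ∀ y : ℝ, ε < |y| → g y = 0)
    (hD : ∀ (j : Fin (n + 1)) (i : ℕ), 1 ≤ i → i ≤ M.k0 → ∀ k : Fin (n + 1) → ℝ,
      ‖dirDeriv (Pi.single j (1 : ℝ)) i M.E k‖ ≤ D ^ i)
    (hCVε : 0 ≤ CV * ε)
    (hvol : volume (bzBox (n + 1) M.latt ∩ {p | |M.E p| ≤ ε}) ≤ ENNReal.ofReal (CV * ε))
    (j : Fin (n + 1)) (nv : Fin (n + 1) → ℤ) :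
    |M.latt * (nv j : ℝ)| ^ M.k0 *
        ‖∫ k in bzBox (n + 1) M.latt,
          Complex.exp (Complex.I * ((∑ i, k i * (M.latt * (nv i : ℝ)) : ℝ) : ℂ)) * g (M.E k)‖ ≤
      ((M.k0).factorial * C * D ^ M.k0) * (CV * ε) := by
  set x : Fin (n + 1) → ℝ := fun i => M.latt * (nv i : ℝ) with hx
  have hb : 0 < Real.pi / M.latt := div_pos Real.pi_pos hM.latt_pos
  have hG : ContDiff ℝ M.k0 (fun k : Fin (n + 1) → ℝ => g (M.E k)) := hg.comp hM.contDiff_E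
  have hper : ∀ k, g (M.E (k + (2 * (Real.pi / M.latt)) • (Pi.single j (1 : ℝ) : Fin (n + 1) → ℝ))) =
      g (M.E k) := comp_E_periodic hM g j
  have hxj : Complex.exp (Complex.I * ((2 * (Real.pi / M.latt) * x j : ℝ) : ℂ)) = 1 :=
    exp_two_b_mul_lattice hM.latt_pos.ne' j nv
  have key := coord_pow_mul_setIntegral_exp_mul j hb x hxj (m := M.k0) hG hper
  -- `bzBox` is the box of the torus lemma
  have hbox : bzBox (n + 1) M.latt = Set.pi Set.univ (fun _ : Fin (n + 1) =>
      Set.Ico (-(Real.pi / M.latt)) (Real.pi / M.latt)) := rfl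
  rw [hbox]
  have hnorm : |M.latt * (nv j : ℝ)| ^ M.k0 *
      ‖∫ k in Set.pi Set.univ (fun _ : Fin (n + 1) => Set.Ico (-(Real.pi / M.latt)) (Real.pi / M.latt)),
        Complex.exp (Complex.I * ((∑ i, k i * x i : ℝ) : ℂ)) * g (M.E k)‖ =
      ‖∫ k in Set.pi Set.univ (fun _ : Fin (n + 1) => Set.Ico (-(Real.pi / M.latt)) (Real.pi / M.latt)),
        Complex.exp (Complex.I * ((∑ i, k i * x i : ℝ) : ℂ)) *
          dirDeriv (Pi.single j (1 : ℝ)) M.k0 (fun k => g (M.E k)) k‖ := by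
    have h1 := congrArg norm key
    rw [norm_mul, norm_mul, norm_pow, norm_pow, Complex.norm_real, Complex.norm_I, one_pow, one_mul,
      Real.norm_eq_abs] at h1
    exact h1
  rw [hnorm]
  refine (norm_setIntegral_phase_mul_le x _ _).trans ?_
  have hbox' : Set.pi Set.univ (fun _ : Fin (n + 1) => Set.Ico (-(Real.pi / M.latt)) (Real.pi / M.latt)) =
      bzBox (n + 1) M.latt := rfl
  rw [hbox']
  refine setIntegral_norm_le_of_shell (by positivity) ?_ ?_ hCVε hvol
  · intro k
    exact norm_dirDeriv_comp_le hg hM.contDiff_E (Pi.single j (1 : ℝ)) hC (hD j) k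
  · intro k hk
    exact dirDeriv_comp_eq_zero hM.contDiff_E.continuous hgz _ _ hk

end Bounds

/-! ### From the four `𝐤`-integral bounds to the bounds on `Ḋ_t` -/

section Assemble

variable {M : ModelData d} {χ₁ : ℝ → ℝ}

/-- Weighted bound of a finite exponential sum with a prefactor.
[cite: Salmhofer1998, Lemma 5 proof (p.20 L84–90)] -/
theorem mul_norm_mul_sum_le {c : ℂ} {e F : ℤ → ℂ} (he : ∀ n, ‖e n‖ ≤ 1) {T : Finset ℤ} {w B : ℝ}
    (hw : 0 ≤ w) (hB : ∀ n ∈ T, w * ‖F n‖ ≤ B) :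
    w * ‖c * ∑ n ∈ T, e n * F n‖ ≤ ‖c‖ * (T.card * B) := by
  rw [norm_mul]
  have h1 : ‖∑ n ∈ T, e n * F n‖ ≤ ∑ n ∈ T, ‖F n‖ := norm_sum_mul_le he F T
  have h2 : ∑ n ∈ T, w * ‖F n‖ ≤ T.card * B := by
    have := Finset.sum_le_card_nsmul T (fun n => w * ‖F n‖) B hB
    rwa [nsmul_eq_mul] at this
  calc w * (‖c‖ * ‖∑ n ∈ T, e n * F n‖) ≤ w * (‖c‖ * ∑ n ∈ T, ‖F n‖) := by gcongr
    _ = ‖c‖ * ∑ n ∈ T, w * ‖F n‖ := by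
        rw [Finset.mul_sum, Finset.mul_sum, Finset.mul_sum]
        exact Finset.sum_congr rfl fun n _ => by ring
    _ ≤ ‖c‖ * (T.card * B) := by gcongr

/-- `‖e^{ix₀ω_n}‖ ≤ 1`. [cite: Salmhofer1998, Lemma 5 proof (p.20 L84–90)] -/
theorem norm_exp_matsFreq_le (β x₀ : ℝ) (n : ℤ) :
    ‖Complex.exp (Complex.I * ((x₀ * matsFreq β n : ℝ) : ℂ))‖ ≤ 1 := by
  rw [mul_comm Complex.I, Complex.norm_exp_ofReal_mul_I]

/-- The norm of the prefactor `β⁻¹(2π)^{-d}`. [cite: Salmhofer1998, Lemma 5 (5.23) (p.20 L70–75)] -/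
theorem norm_prefactor {β : ℝ} (hβ : 0 < β) (d : ℕ) :
    ‖(((β⁻¹ * ((2 * Real.pi) ^ d)⁻¹ : ℝ)) : ℂ)‖ = β⁻¹ * ((2 * Real.pi) ^ d)⁻¹ := by
  rw [Complex.norm_real, Real.norm_eq_abs, abs_of_pos (by positivity)]

/-- Combining the four bounds: `A ≤ N/(max{1,u²}·max{1,w^K})`.
[cite: Salmhofer1998, Lemma 5 proof, last display ⇒ (5.24) (p.20 L103–104)] -/
theorem le_div_max_of_four_bounds {A u w N : ℝ} {K : ℕ} (h1 : A ≤ N) (h2 : u ^ 2 * A ≤ N)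
    (h3 : w ^ K * A ≤ N) (h4 : u ^ 2 * w ^ K * A ≤ N) :
    A ≤ N / (max 1 (u ^ 2) * max 1 (w ^ K)) := by
  have hpos : 0 < max 1 (u ^ 2) * max 1 (w ^ K) := by positivity
  rw [le_div_iff₀ hpos]
  rcases le_total (u ^ 2) 1 with hu | hu <;> rcases le_total (w ^ K) 1 with hw | hw
  · rw [max_eq_left hu, max_eq_left hw]; linarith
  · rw [max_eq_left hu, max_eq_right hw]; linarith
  · rw [max_eq_right hu, max_eq_left hw]; linarith
  · rw [max_eq_right hu, max_eq_right hw]; linarith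

/-- A sup-norm coordinate: `‖v‖ = |v_j|` for some `j` (in dimension `n+1`).
[cite: Salmhofer1998, Lemma 5 proof (5.24) (p.20 L84–86)] -/
theorem exists_norm_eq_abs {n : ℕ} (v : Fin (n + 1) → ℝ) : ∃ j : Fin (n + 1), ‖v‖ = |v j| := by
  have hne : (Finset.univ : Finset (Fin (n + 1))).Nonempty := Finset.univ_nonempty
  obtain ⟨j, _, hj⟩ := Finset.exists_mem_eq_sup' hne (fun j => ‖v j‖₊)
  refine ⟨j, ?_⟩
  have h1 : ‖v‖₊ = ‖v j‖₊ := by rw [Pi.nnnorm_def, ← Finset.sup'_eq_sup hne, hj]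
  rw [← coe_nnnorm, h1, coe_nnnorm, Real.norm_eq_abs]

/-- **(F1)** `‖Ḋ_t(x₀,𝐱)‖ ≤ N₁ ε_t`, `N₁ = (2/π)(2π)^{-d} C_A C_E` (Matsubara count `≤ 2βε_t/π`, each term
`≤ C_A ε_t⁻¹ · C_E ε_t`). [cite: Salmhofer1998, Lemma 5 proof (5.24)–(5.26) (p.20 L84–108)] -/
theorem bound_F1 (hM : M.Hyp) (hχ : IsCutoff χ₁) {CA CV : ℝ} (hCA : 0 ≤ CA)
    (hA : ∀ ε : ℝ, 0 < ε → ∀ (x : ℝ) (n : ℕ), n ≤ M.k0 → ∀ y : ℝ,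
      ‖iteratedDeriv n (scaledSlice (kerProfile χ₁) ε x) y‖ ≤ CA * (ε⁻¹) ^ (n + 1))
    (hV : ∀ ε : ℝ, 0 < ε → ε ≤ 1 →
      volume (bzBox d M.latt ∩ {p | |M.E p| ≤ ε}) ≤ ENNReal.ofReal (CV * ε)) (hCV : 0 ≤ CV)
    {β : ℝ} (hβ : 0 < β) {t : ℝ} (ht : 0 ≤ t) (x₀ : ℝ) (x : Fin d → ℝ) :
    ‖dotCovPos M χ₁ β t x₀ x‖ ≤ (2 / Real.pi * ((2 * Real.pi) ^ d)⁻¹ * CA * CV) * epsT M.eps0 t := by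
  have hε := epsT_pos hM.eps0_pos t
  have hπ := Real.pi_pos
  obtain ⟨S, hS, hcard⟩ := exists_matsubara_support hβ hε.le
  rw [dotCovPos_eq_sum hM hχ hβ t x₀ x hS]
  have hmain := mul_norm_mul_sum_le (c := (((β⁻¹ * ((2 * Real.pi) ^ d)⁻¹ : ℝ)) : ℂ))
    (e := fun n => Complex.exp (Complex.I * ((x₀ * matsFreq β n : ℝ) : ℂ)))
    (F := fun n => ∫ k in bzBox d M.latt, Complex.exp (Complex.I * ((∑ i, k i * x i : ℝ) : ℂ)) *
      covCDot χ₁ M.eps0 t (matsFreq β n) (M.E k))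
    (norm_exp_matsFreq_le β x₀) (T := S) (w := 1) zero_le_one
    (B := CA * (epsT M.eps0 t)⁻¹ * (CV * epsT M.eps0 t)) (fun n _ => by
      rw [one_mul]
      exact (norm_setIntegral_phase_mul_le x _ _).trans (integral_norm_kernel_le hM hχ hCA hA hV hCV ht _))
  rw [one_mul, norm_prefactor hβ] at hmain
  refine hmain.trans ?_
  have hB0 : 0 ≤ CA * (epsT M.eps0 t)⁻¹ * (CV * epsT M.eps0 t) := by positivity
  calc β⁻¹ * ((2 * Real.pi) ^ d)⁻¹ * (S.card * (CA * (epsT M.eps0 t)⁻¹ * (CV * epsT M.eps0 t)))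
      ≤ β⁻¹ * ((2 * Real.pi) ^ d)⁻¹ *
          (2 * β * epsT M.eps0 t / Real.pi * (CA * (epsT M.eps0 t)⁻¹ * (CV * epsT M.eps0 t))) := by
        gcongr
    _ = (2 / Real.pi * ((2 * Real.pi) ^ d)⁻¹ * CA * CV) * epsT M.eps0 t := by
        field_simp

/-- **(F2)** `(ε_t|x₀|)² ‖Ḋ_t(x₀,𝐱)‖ ≤ N₂ ε_t`, `N₂ = (3π/2)(2π)^{-d} C_B C_E`, for `|x₀| ≤ β/2`
(summation by parts twice, `|1 - e^{2πix₀/β}| ≥ 4|x₀|/β`, count `≤ 3·2βε_t/π`, each term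
`≤ C_B (2π/β)² ε_t⁻³ · C_E ε_t`). [cite: Salmhofer1998, Lemma 5 proof (5.24)–(5.26) (p.20 L92–108)] -/
theorem bound_F2 (hM : M.Hyp) (hχ : IsCutoff χ₁) {CB CV : ℝ} (hCB : 0 ≤ CB)
    (hB : ∀ ε : ℝ, 0 < ε → ∀ (x a : ℝ) (n : ℕ), n ≤ M.k0 → ∀ y : ℝ,
      ‖iteratedDeriv n (scaledSlice (kerProfile χ₁) ε x) y -
          2 * iteratedDeriv n (scaledSlice (kerProfile χ₁) ε (x - a)) y +
          iteratedDeriv n (scaledSlice (kerProfile χ₁) ε (x - 2 * a)) y‖ ≤ CB * a ^ 2 * (ε⁻¹) ^ (n + 3))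
    (hV : ∀ ε : ℝ, 0 < ε → ε ≤ 1 →
      volume (bzBox d M.latt ∩ {p | |M.E p| ≤ ε}) ≤ ENNReal.ofReal (CV * ε)) (hCV : 0 ≤ CV)
    {β : ℝ} (hβ : 0 < β) {t : ℝ} (ht : 0 ≤ t) {x₀ : ℝ} (hx₀ : |x₀| ≤ β / 2) (x : Fin d → ℝ) :
    (epsT M.eps0 t * |x₀|) ^ 2 * ‖dotCovPos M χ₁ β t x₀ x‖ ≤
      (3 * Real.pi / 2 * ((2 * Real.pi) ^ d)⁻¹ * CB * CV) * epsT M.eps0 t := by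
  have hε := epsT_pos hM.eps0_pos t
  have hπ := Real.pi_pos
  obtain ⟨S, hS, hcard⟩ := exists_matsubara_support hβ hε.le
  set A := ‖dotCovPos M χ₁ β t x₀ x‖ with hAdef
  have hA0 : 0 ≤ A := norm_nonneg _
  have hrepr := sq_mul_dotCovPos_eq_sum hM hχ hβ t x₀ x hS
  set a : ℝ := 2 * Real.pi / β with ha
  set T := S ∪ S.image (fun n => n + 1) ∪ S.image (fun n => n + 2) with hTdef
  have hT : (T.card : ℝ) ≤ 3 * S.card := card_union_shifts_le S
  have hmain := mul_norm_mul_sum_le (c := (((β⁻¹ * ((2 * Real.pi) ^ d)⁻¹ : ℝ)) : ℂ))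
    (e := fun n => Complex.exp (Complex.I * ((x₀ * matsFreq β n : ℝ) : ℂ)))
    (F := fun n => ∫ k in bzBox d M.latt, Complex.exp (Complex.I * ((∑ i, k i * x i : ℝ) : ℂ)) *
      (covCDot χ₁ M.eps0 t (matsFreq β n) (M.E k) -
        2 * covCDot χ₁ M.eps0 t (matsFreq β n - 2 * Real.pi / β) (M.E k) +
        covCDot χ₁ M.eps0 t (matsFreq β n - 2 * (2 * Real.pi / β)) (M.E k)))
    (norm_exp_matsFreq_le β x₀) (T := T) (w := 1) zero_le_one
    (B := CB * a ^ 2 * ((epsT M.eps0 t)⁻¹) ^ 3 * (CV * epsT M.eps0 t)) (fun n _ => by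
      rw [one_mul]
      refine (norm_setIntegral_phase_mul_le x _ _).trans ?_
      have := integral_norm_kernel_diff_le hM hχ hCB hB hV hCV ht (matsFreq β n) a
      rw [ha] at this ⊢
      exact this)
  rw [one_mul, norm_prefactor hβ, ← hrepr, norm_mul, norm_pow] at hmain
  have hlow := four_mul_abs_div_le_norm_one_sub_exp hβ hx₀
  have hB0 : 0 ≤ CB * a ^ 2 * ((epsT M.eps0 t)⁻¹) ^ 3 * (CV * epsT M.eps0 t) := by positivity
  have h1 : (4 * |x₀| / β) ^ 2 * A ≤
      β⁻¹ * ((2 * Real.pi) ^ d)⁻¹ * (3 * (2 * β * epsT M.eps0 t / Real.pi) *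
        (CB * a ^ 2 * ((epsT M.eps0 t)⁻¹) ^ 3 * (CV * epsT M.eps0 t))) := by
    calc (4 * |x₀| / β) ^ 2 * A
        ≤ ‖1 - Complex.exp (Complex.I * ((x₀ * (2 * Real.pi / β) : ℝ) : ℂ))‖ ^ 2 * A := by
          gcongr
      _ ≤ β⁻¹ * ((2 * Real.pi) ^ d)⁻¹ *
          (T.card * (CB * a ^ 2 * ((epsT M.eps0 t)⁻¹) ^ 3 * (CV * epsT M.eps0 t))) := hmain
      _ ≤ β⁻¹ * ((2 * Real.pi) ^ d)⁻¹ * (3 * (2 * β * epsT M.eps0 t / Real.pi) *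
          (CB * a ^ 2 * ((epsT M.eps0 t)⁻¹) ^ 3 * (CV * epsT M.eps0 t))) := by
          gcongr
          exact hT.trans (by linarith)
  have hid : (epsT M.eps0 t * |x₀|) ^ 2 * A =
      (epsT M.eps0 t) ^ 2 * β ^ 2 / 16 * ((4 * |x₀| / β) ^ 2 * A) := by
    field_simp
    ring
  rw [hid]
  calc (epsT M.eps0 t) ^ 2 * β ^ 2 / 16 * ((4 * |x₀| / β) ^ 2 * A)
      ≤ (epsT M.eps0 t) ^ 2 * β ^ 2 / 16 * (β⁻¹ * ((2 * Real.pi) ^ d)⁻¹ *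
          (3 * (2 * β * epsT M.eps0 t / Real.pi) *
            (CB * a ^ 2 * ((epsT M.eps0 t)⁻¹) ^ 3 * (CV * epsT M.eps0 t)))) := by gcongr
    _ = (3 * Real.pi / 2 * ((2 * Real.pi) ^ d)⁻¹ * CB * CV) * epsT M.eps0 t := by
        rw [ha]
        field_simp
        ring

/-- `(ε⁻¹)^{i+1} ≤ (ε⁻¹)^{K+1}` for `i ≤ K`, `0 < ε ≤ 1`. [cite: Salmhofer1998, Lemma 5 proof (5.25) (p.20 L99–104)] -/
theorem inv_pow_le_inv_pow {ε : ℝ} (hε : 0 < ε) (hε1 : ε ≤ 1) {i K r : ℕ} (hi : i ≤ K) :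
    (ε⁻¹) ^ (i + r) ≤ (ε⁻¹) ^ (K + r) :=
  pow_le_pow_right₀ ((one_le_inv₀ hε).mpr hε1) (by omega)

/-- **(F3)** `(ε_t|x_j|)^{k₀} ‖Ḋ_t(x₀,𝐱)‖ ≤ N₃ ε_t`, `N₃ = (2/π)(2π)^{-d} k₀! C_A D^{k₀} C_E`, for
`𝐱 ∈ εℤ^{n+1}` (`k₀` integrations by parts in the coordinate `j`).
[cite: Salmhofer1998, Lemma 5 proof (5.24)–(5.26) (p.20 L84–108)] -/
theorem bound_F3 {n : ℕ} {M : ModelData (n + 1)} (hM : M.Hyp) (hχ : IsCutoff χ₁) {CA CV D : ℝ}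
    (hCA : 0 ≤ CA) (hD1 : 1 ≤ D)
    (hA : ∀ ε : ℝ, 0 < ε → ∀ (x : ℝ) (m : ℕ), m ≤ M.k0 → ∀ y : ℝ,
      ‖iteratedDeriv m (scaledSlice (kerProfile χ₁) ε x) y‖ ≤ CA * (ε⁻¹) ^ (m + 1))
    (hV : ∀ ε : ℝ, 0 < ε → ε ≤ 1 →
      volume (bzBox (n + 1) M.latt ∩ {p | |M.E p| ≤ ε}) ≤ ENNReal.ofReal (CV * ε)) (hCV : 0 ≤ CV)
    (hD : ∀ (j : Fin (n + 1)) (i : ℕ), 1 ≤ i → i ≤ M.k0 → ∀ k : Fin (n + 1) → ℝ,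
      ‖dirDeriv (Pi.single j (1 : ℝ)) i M.E k‖ ≤ D ^ i)
    {β : ℝ} (hβ : 0 < β) {t : ℝ} (ht : 0 ≤ t) (x₀ : ℝ) (nv : Fin (n + 1) → ℤ) (j : Fin (n + 1)) :
    (epsT M.eps0 t * |M.latt * (nv j : ℝ)|) ^ M.k0 *
        ‖dotCovPos M χ₁ β t x₀ (fun i => M.latt * (nv i : ℝ))‖ ≤
      (2 / Real.pi * ((2 * Real.pi) ^ (n + 1))⁻¹ * (M.k0).factorial * CA * D ^ M.k0 * CV) *
        epsT M.eps0 t := by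
  have hε := epsT_pos hM.eps0_pos t
  have hε1 := epsT_le_one hM ht
  have hπ := Real.pi_pos
  set ε := epsT M.eps0 t with hεdef
  set x : Fin (n + 1) → ℝ := fun i => M.latt * (nv i : ℝ) with hx
  obtain ⟨S, hS, hcard⟩ := exists_matsubara_support hβ hε.le
  rw [dotCovPos_eq_sum hM hχ hβ t x₀ x hS]
  have hw0 : 0 ≤ |M.latt * (nv j : ℝ)| ^ M.k0 := by positivity
  -- the derivative bounds of `y ↦ 𝒞̇_t(x', y)` up to order `k₀`
  have hC : ∀ (x' : ℝ) (i : ℕ), i ≤ M.k0 → ∀ y : ℝ,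
      ‖iteratedDeriv i (fun y => covCDot χ₁ M.eps0 t x' y) y‖ ≤ CA * (ε⁻¹) ^ (M.k0 + 1) := by
    intro x' i hi y
    rw [covCDot_fun_eq_scaledSlice hχ hM.eps0_pos]
    refine (hA ε hε x' i hi y).trans ?_
    exact mul_le_mul_of_nonneg_left (inv_pow_le_inv_pow hε hε1 hi) hCA
  have hmain := mul_norm_mul_sum_le (c := (((β⁻¹ * ((2 * Real.pi) ^ (n + 1))⁻¹ : ℝ)) : ℂ))
    (e := fun m => Complex.exp (Complex.I * ((x₀ * matsFreq β m : ℝ) : ℂ)))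
    (F := fun m => ∫ k in bzBox (n + 1) M.latt, Complex.exp (Complex.I * ((∑ i, k i * x i : ℝ) : ℂ)) *
      covCDot χ₁ M.eps0 t (matsFreq β m) (M.E k))
    (norm_exp_matsFreq_le β x₀) (T := S) hw0
    (B := ((M.k0).factorial * (CA * (ε⁻¹) ^ (M.k0 + 1)) * D ^ M.k0) * (CV * ε)) (fun m _ =>
      pow_mul_norm_integral_le hM ((contDiff_covCDot hχ hM.eps0_pos t _).of_le (mod_cast le_top))
        (by positivity) hD1 (hC _) (fun y hy => covCDot_eq_zero_of_lt' hχ hM.eps0_pos _ hy) hD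
        (by positivity) (hV ε hε hε1) j nv)
  rw [norm_prefactor hβ] at hmain
  have hB0 : 0 ≤ ((M.k0).factorial * (CA * (ε⁻¹) ^ (M.k0 + 1)) * D ^ M.k0) * (CV * ε) := by positivity
  have h1 : |M.latt * (nv j : ℝ)| ^ M.k0 *
      ‖(((β⁻¹ * ((2 * Real.pi) ^ (n + 1))⁻¹ : ℝ)) : ℂ) * ∑ m ∈ S,
        Complex.exp (Complex.I * ((x₀ * matsFreq β m : ℝ) : ℂ)) *
          ∫ k in bzBox (n + 1) M.latt, Complex.exp (Complex.I * ((∑ i, k i * x i : ℝ) : ℂ)) *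
            covCDot χ₁ M.eps0 t (matsFreq β m) (M.E k)‖ ≤
      β⁻¹ * ((2 * Real.pi) ^ (n + 1))⁻¹ * (2 * β * ε / Real.pi *
        (((M.k0).factorial * (CA * (ε⁻¹) ^ (M.k0 + 1)) * D ^ M.k0) * (CV * ε))) := by
    refine hmain.trans ?_
    gcongr
  have hid : (ε * |M.latt * (nv j : ℝ)|) ^ M.k0 = ε ^ M.k0 * |M.latt * (nv j : ℝ)| ^ M.k0 := mul_pow _ _ _
  rw [hid, mul_assoc]
  calc ε ^ M.k0 * (|M.latt * (nv j : ℝ)| ^ M.k0 * ‖(((β⁻¹ * ((2 * Real.pi) ^ (n + 1))⁻¹ : ℝ)) : ℂ) *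
        ∑ m ∈ S, Complex.exp (Complex.I * ((x₀ * matsFreq β m : ℝ) : ℂ)) *
          ∫ k in bzBox (n + 1) M.latt, Complex.exp (Complex.I * ((∑ i, k i * x i : ℝ) : ℂ)) *
            covCDot χ₁ M.eps0 t (matsFreq β m) (M.E k)‖)
      ≤ ε ^ M.k0 * (β⁻¹ * ((2 * Real.pi) ^ (n + 1))⁻¹ * (2 * β * ε / Real.pi *
        (((M.k0).factorial * (CA * (ε⁻¹) ^ (M.k0 + 1)) * D ^ M.k0) * (CV * ε)))) := by gcongr
    _ = (2 / Real.pi * ((2 * Real.pi) ^ (n + 1))⁻¹ * (M.k0).factorial * CA * D ^ M.k0 * CV) * ε := by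
        have h2 : ε ^ M.k0 * (ε⁻¹) ^ (M.k0 + 1) = ε⁻¹ := by
          rw [pow_succ, ← mul_assoc, ← mul_pow, mul_inv_cancel₀ hε.ne', one_pow, one_mul]
        calc ε ^ M.k0 * (β⁻¹ * ((2 * Real.pi) ^ (n + 1))⁻¹ * (2 * β * ε / Real.pi *
              (((M.k0).factorial * (CA * (ε⁻¹) ^ (M.k0 + 1)) * D ^ M.k0) * (CV * ε))))
            = (2 / Real.pi * ((2 * Real.pi) ^ (n + 1))⁻¹ * (M.k0).factorial * CA * D ^ M.k0 * CV) *
                (ε ^ M.k0 * (ε⁻¹) ^ (M.k0 + 1)) * (β⁻¹ * β) * (ε * ε) := by ring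
          _ = (2 / Real.pi * ((2 * Real.pi) ^ (n + 1))⁻¹ * (M.k0).factorial * CA * D ^ M.k0 * CV) * ε := by
                rw [h2, inv_mul_cancel₀ hβ.ne']
                field_simp

/-- **(F4)** `(ε_t|x₀|)² (ε_t|x_j|)^{k₀} ‖Ḋ_t(x₀,𝐱)‖ ≤ N₄ ε_t`, `N₄ = (3π/2)(2π)^{-d} k₀! C_B D^{k₀} C_E`,
for `|x₀| ≤ β/2`, `𝐱 ∈ εℤ^{n+1}` (summation by parts twice and `k₀` integrations by parts).
[cite: Salmhofer1998, Lemma 5 proof (5.24)–(5.26) (p.20 L84–108)] -/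
theorem bound_F4 {n : ℕ} {M : ModelData (n + 1)} (hM : M.Hyp) (hχ : IsCutoff χ₁) {CB CV D : ℝ}
    (hCB : 0 ≤ CB) (hD1 : 1 ≤ D)
    (hB : ∀ ε : ℝ, 0 < ε → ∀ (x a : ℝ) (m : ℕ), m ≤ M.k0 → ∀ y : ℝ,
      ‖iteratedDeriv m (scaledSlice (kerProfile χ₁) ε x) y -
          2 * iteratedDeriv m (scaledSlice (kerProfile χ₁) ε (x - a)) y +
          iteratedDeriv m (scaledSlice (kerProfile χ₁) ε (x - 2 * a)) y‖ ≤ CB * a ^ 2 * (ε⁻¹) ^ (m + 3))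
    (hV : ∀ ε : ℝ, 0 < ε → ε ≤ 1 →
      volume (bzBox (n + 1) M.latt ∩ {p | |M.E p| ≤ ε}) ≤ ENNReal.ofReal (CV * ε)) (hCV : 0 ≤ CV)
    (hD : ∀ (j : Fin (n + 1)) (i : ℕ), 1 ≤ i → i ≤ M.k0 → ∀ k : Fin (n + 1) → ℝ,
      ‖dirDeriv (Pi.single j (1 : ℝ)) i M.E k‖ ≤ D ^ i)
    {β : ℝ} (hβ : 0 < β) {t : ℝ} (ht : 0 ≤ t) {x₀ : ℝ} (hx₀ : |x₀| ≤ β / 2) (nv : Fin (n + 1) → ℤ)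
    (j : Fin (n + 1)) :
    (epsT M.eps0 t * |x₀|) ^ 2 * ((epsT M.eps0 t * |M.latt * (nv j : ℝ)|) ^ M.k0 *
        ‖dotCovPos M χ₁ β t x₀ (fun i => M.latt * (nv i : ℝ))‖) ≤
      (3 * Real.pi / 2 * ((2 * Real.pi) ^ (n + 1))⁻¹ * (M.k0).factorial * CB * D ^ M.k0 * CV) *
        epsT M.eps0 t := by
  have hε := epsT_pos hM.eps0_pos t
  have hε1 := epsT_le_one hM ht
  have hπ := Real.pi_pos
  have hΦs := contDiff_kerProfile hχ
  set ε := epsT M.eps0 t with hεdef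
  set x : Fin (n + 1) → ℝ := fun i => M.latt * (nv i : ℝ) with hx
  set A := ‖dotCovPos M χ₁ β t x₀ x‖ with hAdef
  have hA0 : 0 ≤ A := norm_nonneg _
  obtain ⟨S, hS, hcard⟩ := exists_matsubara_support hβ hε.le
  have hrepr := sq_mul_dotCovPos_eq_sum hM hχ hβ t x₀ x hS
  set a : ℝ := 2 * Real.pi / β with ha
  set T := S ∪ S.image (fun n => n + 1) ∪ S.image (fun n => n + 2) with hTdef
  have hT : (T.card : ℝ) ≤ 3 * S.card := card_union_shifts_le S
  have hw0 : 0 ≤ |M.latt * (nv j : ℝ)| ^ M.k0 := by positivity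
  -- the second-difference kernel as a function of `y`, and its derivative bounds
  have hfun : ∀ x' : ℝ, (fun y : ℝ => covCDot χ₁ M.eps0 t x' y - 2 * covCDot χ₁ M.eps0 t (x' - a) y +
      covCDot χ₁ M.eps0 t (x' - 2 * a) y) = fun y => scaledSlice (kerProfile χ₁) ε x' y -
        2 * scaledSlice (kerProfile χ₁) ε (x' - a) y + scaledSlice (kerProfile χ₁) ε (x' - 2 * a) y := by
    intro x'; funext y; simp only [covCDot_eq_scaledSlice hχ hM.eps0_pos, hεdef]
  have hC : ∀ (x' : ℝ) (i : ℕ), i ≤ M.k0 → ∀ y : ℝ,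
      ‖iteratedDeriv i (fun y : ℝ => covCDot χ₁ M.eps0 t x' y - 2 * covCDot χ₁ M.eps0 t (x' - a) y +
        covCDot χ₁ M.eps0 t (x' - 2 * a) y) y‖ ≤ CB * a ^ 2 * (ε⁻¹) ^ (M.k0 + 3) := by
    intro x' i hi y
    rw [hfun x', iteratedDeriv_scaledSlice_secondDiff hΦs]
    refine (hB ε hε x' a i hi y).trans ?_
    exact mul_le_mul_of_nonneg_left (inv_pow_le_inv_pow hε hε1 hi) (by positivity)
  have hg : ∀ x' : ℝ, ContDiff ℝ M.k0 (fun y : ℝ => covCDot χ₁ M.eps0 t x' y -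
      2 * covCDot χ₁ M.eps0 t (x' - a) y + covCDot χ₁ M.eps0 t (x' - 2 * a) y) := by
    intro x'
    rw [hfun x']
    exact (contDiff_scaledSlice_secondDiff hΦs ε x' a).of_le (mod_cast le_top)
  have hgz : ∀ (x' y : ℝ), ε < |y| → covCDot χ₁ M.eps0 t x' y - 2 * covCDot χ₁ M.eps0 t (x' - a) y +
      covCDot χ₁ M.eps0 t (x' - 2 * a) y = 0 := by
    intro x' y hy
    rw [covCDot_eq_zero_of_lt' hχ hM.eps0_pos x' hy, covCDot_eq_zero_of_lt' hχ hM.eps0_pos _ hy,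
      covCDot_eq_zero_of_lt' hχ hM.eps0_pos _ hy]
    ring
  have hmain := mul_norm_mul_sum_le (c := (((β⁻¹ * ((2 * Real.pi) ^ (n + 1))⁻¹ : ℝ)) : ℂ))
    (e := fun m => Complex.exp (Complex.I * ((x₀ * matsFreq β m : ℝ) : ℂ)))
    (F := fun m => ∫ k in bzBox (n + 1) M.latt, Complex.exp (Complex.I * ((∑ i, k i * x i : ℝ) : ℂ)) *
      (covCDot χ₁ M.eps0 t (matsFreq β m) (M.E k) -
        2 * covCDot χ₁ M.eps0 t (matsFreq β m - 2 * Real.pi / β) (M.E k) +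
        covCDot χ₁ M.eps0 t (matsFreq β m - 2 * (2 * Real.pi / β)) (M.E k)))
    (norm_exp_matsFreq_le β x₀) (T := T) hw0
    (B := ((M.k0).factorial * (CB * a ^ 2 * (ε⁻¹) ^ (M.k0 + 3)) * D ^ M.k0) * (CV * ε)) (fun m _ => by
      have := pow_mul_norm_integral_le hM (hg (matsFreq β m)) (by positivity) hD1 (hC _) (hgz _) hD
        (by positivity) (hV ε hε hε1) j nv
      rw [ha] at this ⊢
      exact this)
  rw [norm_prefactor hβ, ← hrepr, norm_mul, norm_pow] at hmain
  have hlow := four_mul_abs_div_le_norm_one_sub_exp hβ hx₀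
  have hB0 : 0 ≤ ((M.k0).factorial * (CB * a ^ 2 * (ε⁻¹) ^ (M.k0 + 3)) * D ^ M.k0) * (CV * ε) := by
    positivity
  have h1 : (4 * |x₀| / β) ^ 2 * (|M.latt * (nv j : ℝ)| ^ M.k0 * A) ≤
      β⁻¹ * ((2 * Real.pi) ^ (n + 1))⁻¹ * (3 * (2 * β * ε / Real.pi) *
        (((M.k0).factorial * (CB * a ^ 2 * (ε⁻¹) ^ (M.k0 + 3)) * D ^ M.k0) * (CV * ε))) := by
    calc (4 * |x₀| / β) ^ 2 * (|M.latt * (nv j : ℝ)| ^ M.k0 * A)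
        ≤ ‖1 - Complex.exp (Complex.I * ((x₀ * (2 * Real.pi / β) : ℝ) : ℂ))‖ ^ 2 *
            (|M.latt * (nv j : ℝ)| ^ M.k0 * A) := by gcongr
      _ = |M.latt * (nv j : ℝ)| ^ M.k0 *
            (‖1 - Complex.exp (Complex.I * ((x₀ * (2 * Real.pi / β) : ℝ) : ℂ))‖ ^ 2 * A) := by ring
      _ ≤ β⁻¹ * ((2 * Real.pi) ^ (n + 1))⁻¹ *
          (T.card * (((M.k0).factorial * (CB * a ^ 2 * (ε⁻¹) ^ (M.k0 + 3)) * D ^ M.k0) * (CV * ε))) :=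
          hmain
      _ ≤ β⁻¹ * ((2 * Real.pi) ^ (n + 1))⁻¹ * (3 * (2 * β * ε / Real.pi) *
          (((M.k0).factorial * (CB * a ^ 2 * (ε⁻¹) ^ (M.k0 + 3)) * D ^ M.k0) * (CV * ε))) := by
          gcongr
          exact hT.trans (by linarith)
  have hid : (ε * |x₀|) ^ 2 * ((ε * |M.latt * (nv j : ℝ)|) ^ M.k0 * A) =
      ε ^ 2 * β ^ 2 / 16 * ε ^ M.k0 * ((4 * |x₀| / β) ^ 2 * (|M.latt * (nv j : ℝ)| ^ M.k0 * A)) := by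
    rw [mul_pow ε]
    field_simp
    ring
  rw [hid]
  have hY : ε ^ M.k0 * (ε⁻¹) ^ (M.k0 + 3) = (ε⁻¹) ^ 3 := by
    rw [pow_add, ← mul_assoc, ← mul_pow, mul_inv_cancel₀ hε.ne', one_pow, one_mul]
  calc ε ^ 2 * β ^ 2 / 16 * ε ^ M.k0 * ((4 * |x₀| / β) ^ 2 * (|M.latt * (nv j : ℝ)| ^ M.k0 * A))
      ≤ ε ^ 2 * β ^ 2 / 16 * ε ^ M.k0 * (β⁻¹ * ((2 * Real.pi) ^ (n + 1))⁻¹ * (3 * (2 * β * ε / Real.pi) *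
        (((M.k0).factorial * (CB * a ^ 2 * (ε⁻¹) ^ (M.k0 + 3)) * D ^ M.k0) * (CV * ε)))) := by
        gcongr
    _ = (3 * Real.pi / 2 * ((2 * Real.pi) ^ (n + 1))⁻¹ * (M.k0).factorial * CB * D ^ M.k0 * CV) *
          ((ε ^ M.k0 * (ε⁻¹) ^ (M.k0 + 3)) * ε ^ 3) * (β⁻¹ * β) * (a ^ 2 * β ^ 2 / (4 * Real.pi ^ 2)) *
          ε := by
        rw [ha]
        field_simp
        ring
    _ = (3 * Real.pi / 2 * ((2 * Real.pi) ^ (n + 1))⁻¹ * (M.k0).factorial * CB * D ^ M.k0 * CV) * ε := by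
        rw [hY, inv_mul_cancel₀ hβ.ne', ha]
        field_simp
        ring

/-- `N_i ε ≤ N ε` bookkeeping. [cite: Salmhofer1998, Lemma 5 proof (5.24) (p.20 L84–86)] -/
theorem mul_le_mul_eps {Ni N ε : ℝ} (h : Ni ≤ N) (hε : 0 ≤ ε) {A : ℝ} (hA : A ≤ Ni * ε) : A ≤ N * ε :=
  hA.trans (mul_le_mul_of_nonneg_right h hε)

/-- **Claim (5.24), sup-norm form.**  For the §2.3 class of models and a cutoff `χ₁` there is
`N ≥ 0` (depending on the model and `χ₁` only) such that for all `β > 0`, `t ≥ 0`, `|x₀| ≤ β/2` and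
`𝐱 = ε𝐧 ∈ εℤ^d`:
`‖Ḋ_t(x₀,𝐱)‖ ≤ N ε_t / (max{1, (ε_t|x₀|)²} · max{1, (ε_t‖𝐱‖_∞)^{k₀}})`
(print: `|Ḋ_t(x₀,𝐱)| ≤ N ε_t (1+ε_t|𝐱|)^{-k₀}(1+ε_t min{|x₀|, β/2-|x₀|})^{-2}`).
[cite: Salmhofer1998, Lemma 5 proof, claim (5.24) (p.20 L84–86) and its proof (p.20 L92–104)] -/
theorem exists_dotCovPos_decay {M : ModelData d} (hM : M.Hyp) {χ₁ : ℝ → ℝ} (hχ : IsCutoff χ₁) :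
    ∃ N : ℝ, 0 ≤ N ∧ ∀ β : ℝ, 0 < β → ∀ t : ℝ, 0 ≤ t → ∀ x₀ : ℝ, |x₀| ≤ β / 2 →
      ∀ nv : Fin d → ℤ,
        ‖dotCovPos M χ₁ β t x₀ (fun i => M.latt * (nv i : ℝ))‖ ≤
          N * epsT M.eps0 t / (max 1 ((epsT M.eps0 t * |x₀|) ^ 2) *
            max 1 ((epsT M.eps0 t * ‖(fun i => M.latt * (nv i : ℝ) : Fin d → ℝ)‖) ^ M.k0)) := by
  have hΦs := contDiff_kerProfile hχ
  have hΦc := hasCompactSupport_kerProfile hχ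
  obtain ⟨CA, hCA, hA⟩ := exists_bound_iteratedDeriv_scaledSlice hΦs hΦc M.k0
  obtain ⟨CB, hCB, hB⟩ := exists_bound_secondDiff_iteratedDeriv_scaledSlice hΦs hΦc M.k0
  obtain ⟨CV, hCV, hV⟩ := exists_sublevel_volume_le hM
  have hπ := Real.pi_pos
  have hK : M.k0 ≠ 0 := by have := hM.two_le_k0; omega
  cases d with
  | zero =>
    refine ⟨2 / Real.pi * ((2 * Real.pi) ^ 0)⁻¹ * CA * CV + 3 * Real.pi / 2 * ((2 * Real.pi) ^ 0)⁻¹ * CB * CV,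
      by positivity, ?_⟩
    intro β hβ t ht x₀ hx₀ nv
    have hε := epsT_pos hM.eps0_pos t
    have hnorm : ‖(fun i => M.latt * (nv i : ℝ) : Fin 0 → ℝ)‖ = 0 := by
      rw [Subsingleton.elim (fun i => M.latt * (nv i : ℝ) : Fin 0 → ℝ) 0, norm_zero]
    have h1 := bound_F1 hM hχ hCA hA hV hCV hβ ht x₀ (fun i => M.latt * (nv i : ℝ))
    have h2 := bound_F2 hM hχ hCB hB hV hCV hβ ht hx₀ (fun i => M.latt * (nv i : ℝ))
    have hN1 : 2 / Real.pi * ((2 * Real.pi) ^ 0)⁻¹ * CA * CV ≤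
        2 / Real.pi * ((2 * Real.pi) ^ 0)⁻¹ * CA * CV + 3 * Real.pi / 2 * ((2 * Real.pi) ^ 0)⁻¹ * CB * CV := by
      have : 0 ≤ 3 * Real.pi / 2 * ((2 * Real.pi) ^ 0)⁻¹ * CB * CV := by positivity
      linarith
    have hN2 : 3 * Real.pi / 2 * ((2 * Real.pi) ^ 0)⁻¹ * CB * CV ≤
        2 / Real.pi * ((2 * Real.pi) ^ 0)⁻¹ * CA * CV + 3 * Real.pi / 2 * ((2 * Real.pi) ^ 0)⁻¹ * CB * CV := by
      have : 0 ≤ 2 / Real.pi * ((2 * Real.pi) ^ 0)⁻¹ * CA * CV := by positivity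
      linarith
    refine le_div_max_of_four_bounds (mul_le_mul_eps hN1 hε.le h1) (mul_le_mul_eps hN2 hε.le h2) ?_ ?_
    · rw [hnorm, mul_zero, zero_pow hK, zero_mul]; positivity
    · rw [hnorm, mul_zero, zero_pow hK, mul_zero, zero_mul]; positivity
  | succ n =>
    have hP : 0 < 2 * Real.pi / M.latt := div_pos (by positivity) hM.latt_pos
    obtain ⟨D, hD1, hD⟩ := exists_bound_dirDeriv_periodic (N := M.k0) hM.contDiff_E hP
      (fun k z => hM.periodic_E k z)
    have hD0 : 0 ≤ D := by linarith
    set c : ℝ := ((2 * Real.pi) ^ (n + 1))⁻¹ with hc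
    set N₁ : ℝ := 2 / Real.pi * c * CA * CV with hN₁
    set N₂ : ℝ := 3 * Real.pi / 2 * c * CB * CV with hN₂
    set N₃ : ℝ := 2 / Real.pi * c * (M.k0).factorial * CA * D ^ M.k0 * CV with hN₃
    set N₄ : ℝ := 3 * Real.pi / 2 * c * (M.k0).factorial * CB * D ^ M.k0 * CV with hN₄
    have h10 : 0 ≤ N₁ := by positivity
    have h20 : 0 ≤ N₂ := by positivity
    have h30 : 0 ≤ N₃ := by positivity
    have h40 : 0 ≤ N₄ := by positivity
    refine ⟨N₁ + N₂ + N₃ + N₄, by positivity, ?_⟩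
    intro β hβ t ht x₀ hx₀ nv
    have hε := epsT_pos hM.eps0_pos t
    obtain ⟨j, hj⟩ := exists_norm_eq_abs (fun i => M.latt * (nv i : ℝ))
    have h1 := bound_F1 hM hχ hCA hA hV hCV hβ ht x₀ (fun i => M.latt * (nv i : ℝ))
    have h2 := bound_F2 hM hχ hCB hB hV hCV hβ ht hx₀ (fun i => M.latt * (nv i : ℝ))
    have h3 := bound_F3 hM hχ hCA hD1 hA hV hCV hD hβ ht x₀ nv j
    have h4 := bound_F4 hM hχ hCB hD1 hB hV hCV hD hβ ht hx₀ nv j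
    rw [hj]
    refine le_div_max_of_four_bounds (mul_le_mul_eps (by linarith) hε.le h1)
      (mul_le_mul_eps (by linarith) hε.le h2) (mul_le_mul_eps (by linarith) hε.le h3) ?_
    rw [mul_assoc]
    exact mul_le_mul_eps (by linarith) hε.le h4

end Assemble

end Salmhofer1998

end Literature.MathematicalPhysics.QuantumLattice.FermiRG
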